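import Mathlib
import Summits.Ventures.PercRepro2.Defs

/-!
# The abstract BLOCK lemma of the pendant sign method (blind cell PercRepro2, night-2 g3;
proofs/NIGHT2-DARC.md §17)

Let `𝒲` be a finite family of traces with masses `μ ≥ 0`, `Λ, MX, MY` the centring data of the
whole trace law (`Λ = Σ μ`, `MX = Σ μ x`, `MY = Σ μ y` over ALL traces) and `x̃, ỹ` data on `𝒲`.
If the trace law restricted to `𝒲` is positively associated for `(1 − x̃, 1 − ỹ)` (cleared form, as
produced by `trace_pa` / `trace_cu_pa`) and the two SHIFTS `Λ·Σ_𝒲 x̃ μ − MX·Σ_𝒲 μ`,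
`Λ·Σ_𝒲 ỹ μ − MY·Σ_𝒲 μ` have the same sign, then the block
`G(𝒲) = Σ_𝒲 μ (x̃ Λ − MX)(ỹ Λ − MY)` is nonnegative (`block_nonneg`): this is the one algebraic
fact behind NIGHT2-DARC.md §15.7 (a), (b) and §15.8 — `ν·G = Λ²(ν·SXY − SX·SY) + (shift_X)(shift_Y)`
with `ν = Σ_𝒲 μ`.
-/

namespace Summit.Ventures.PercRepro2.Coin

section Block

variable {R : Type*} [Field R] [LinearOrder R] [IsStrictOrderedRing R]

omit [LinearOrder R] [IsStrictOrderedRing R] in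
/-- The polynomial core: `ν · G = Λ²(ν·SXY − SX·SY) + (SX·Λ − MX·ν)(SY·Λ − MY·ν)`. -/
lemma block_identity (ν SX SY SXY Λ MX MY : R) :
    ν * (Λ ^ 2 * SXY - Λ * MY * SX - Λ * MX * SY + MX * MY * ν) =
      Λ ^ 2 * (ν * SXY - SX * SY) + (SX * Λ - MX * ν) * (SY * Λ - MY * ν) := by
  ring

/-- **The abstract block lemma.** For a finite family `W` of traces with masses `μ ≥ 0`, data
`x, y` and centring constants `Λ, MX, MY`: positive association on `W` for `(1 − x, 1 − y)`
(cleared form) and same-sign shifts give `Σ_W μ (xΛ − MX)(yΛ − MY) ≥ 0`. -/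
theorem block_nonneg {ι : Type*} (W : Finset ι) (μ x y : ι → R) (Λ MX MY : R)
    (hμ : ∀ i ∈ W, 0 ≤ μ i)
    (hPA : (∑ i ∈ W, (1 - x i) * μ i) * (∑ i ∈ W, (1 - y i) * μ i) ≤
      (∑ i ∈ W, (1 - x i) * (1 - y i) * μ i) * ∑ i ∈ W, μ i)
    (hsh : (MX * ∑ i ∈ W, μ i ≤ (∑ i ∈ W, x i * μ i) * Λ ∧
        MY * ∑ i ∈ W, μ i ≤ (∑ i ∈ W, y i * μ i) * Λ) ∨
      ((∑ i ∈ W, x i * μ i) * Λ ≤ MX * ∑ i ∈ W, μ i ∧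
        (∑ i ∈ W, y i * μ i) * Λ ≤ MY * ∑ i ∈ W, μ i)) :
    0 ≤ ∑ i ∈ W, μ i * (x i * Λ - MX) * (y i * Λ - MY) := by
  -- the four sums
  obtain ⟨ν, hν⟩ : ∃ ν : R, ν = ∑ i ∈ W, μ i := ⟨_, rfl⟩
  obtain ⟨SX, hSX⟩ : ∃ S : R, S = ∑ i ∈ W, x i * μ i := ⟨_, rfl⟩
  obtain ⟨SY, hSY⟩ : ∃ S : R, S = ∑ i ∈ W, y i * μ i := ⟨_, rfl⟩
  obtain ⟨SXY, hSXY⟩ : ∃ S : R, S = ∑ i ∈ W, x i * y i * μ i := ⟨_, rfl⟩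
  have e1 : ∑ i ∈ W, (1 - x i) * μ i = ν - SX := by
    rw [hν, hSX, ← Finset.sum_sub_distrib]
    exact Finset.sum_congr rfl fun i _ => by ring
  have e2 : ∑ i ∈ W, (1 - y i) * μ i = ν - SY := by
    rw [hν, hSY, ← Finset.sum_sub_distrib]
    exact Finset.sum_congr rfl fun i _ => by ring
  have e12 : ∑ i ∈ W, (1 - x i) * (1 - y i) * μ i = ν - SX - SY + SXY := by
    rw [hν, hSX, hSY, hSXY, ← Finset.sum_sub_distrib, ← Finset.sum_sub_distrib,
      ← Finset.sum_add_distrib]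
    exact Finset.sum_congr rfl fun i _ => by ring
  have eG : ∑ i ∈ W, μ i * (x i * Λ - MX) * (y i * Λ - MY) =
      Λ ^ 2 * SXY - Λ * MY * SX - Λ * MX * SY + MX * MY * ν := by
    rw [hν, hSX, hSY, hSXY, Finset.mul_sum, Finset.mul_sum, Finset.mul_sum, Finset.mul_sum,
      ← Finset.sum_sub_distrib, ← Finset.sum_sub_distrib, ← Finset.sum_add_distrib]
    exact Finset.sum_congr rfl fun i _ => by ring
  rw [e1, e2, e12, ← hν] at hPA
  rw [← hν, ← hSX, ← hSY] at hsh
  rw [eG]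
  have hpa' : SX * SY ≤ ν * SXY := by nlinarith [hPA]
  have hνn : 0 ≤ ν := by rw [hν]; exact Finset.sum_nonneg hμ
  have hsh' : 0 ≤ (SX * Λ - MX * ν) * (SY * Λ - MY * ν) := by
    rcases hsh with ⟨h1, h2⟩ | ⟨h1, h2⟩
    · exact mul_nonneg (by linarith) (by linarith)
    · exact mul_nonneg_of_nonpos_of_nonpos (by linarith) (by linarith)
  have hνG : 0 ≤ ν * (Λ ^ 2 * SXY - Λ * MY * SX - Λ * MX * SY + MX * MY * ν) := by
    rw [block_identity]
    have h1 : 0 ≤ Λ ^ 2 * (ν * SXY - SX * SY) := mul_nonneg (sq_nonneg _) (by linarith)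
    linarith
  rcases hνn.eq_or_lt with hν0 | hνpos
  · -- all masses of `W` vanish
    have hall : ∀ i ∈ W, μ i = 0 := by
      rw [hν] at hν0
      exact (Finset.sum_eq_zero_iff_of_nonneg hμ).mp hν0.symm
    have hSX0 : SX = 0 := by
      rw [hSX]; exact Finset.sum_eq_zero fun i hi => by rw [hall i hi, mul_zero]
    have hSY0 : SY = 0 := by
      rw [hSY]; exact Finset.sum_eq_zero fun i hi => by rw [hall i hi, mul_zero]
    have hSXY0 : SXY = 0 := by
      rw [hSXY]; exact Finset.sum_eq_zero fun i hi => by rw [hall i hi, mul_zero]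
    rw [hSX0, hSY0, hSXY0, ← hν0]
    ring_nf
    exact le_refl 0
  · exact (mul_nonneg_iff_of_pos_left hνpos).mp hνG

end Block

end Summit.Ventures.PercRepro2.Coin
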